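import Summits.FinalStateConjecture.FinalStateConjecture.Theses.ZeroEnergyKerrOrBomb
import Summits.FinalStateConjecture.FinalStateConjecture.Theorems.ErgoregionBomb.Negative.TrappingClauseVacuous
import Literature.Geometry.Lorentzian.GlobalHyperbolicityStrongCausalityProofs
import Literature.Geometry.Lorentzian.NonImprisonmentProofs
import Literature.Geometry.Lorentzian.GeodesicRayEndless
import Literature.Analysis.ODE.QuadraticAccelerationEscape

/-!
# `ErgoregionBomb` (crux `stmt-FinalStateConjecture-10691`, route `ZeroEnergyKerrOrBomb`) — proved,
# VACUOUSLY: the antecedent of the crux as typed is contradictory (line `Sketch`, lead prover)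

The crux quantifies over holes `𝓑` of the telescope carrying a null geodesic half-ray `γ|[0,∞)`
(affinely parametrised, `IsGeodesicOn … (Set.Ici 0)`, velocity null hence non-zero) which stays in
a compact subset `K` of SPACETIME (`∀ s ≥ 0, γ s ∈ K`). On the telescope's carrier (Hausdorff,
second countable, connected, boundaryless, `C^∞` metric) this contradicts the hypothesis
`IsGloballyHyperbolic` (causal + compact causal diamonds):

* Bernal–Sánchez 2007, Thm. 3.2: globally hyperbolic ⇒ strongly causal
  (`LorentzianMetric.bernalSanchez_isStronglyCausal_of_isGloballyHyperbolic_holds`) — `stub_bernalSanchez`;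
* O'Neill 1983, Ch. 14, Lemma 13 / Hawking–Ellis 1973, Prop. 6.4.7: under strong causality no
  future-endless causal curve is imprisoned in a compact set
  (`LorentzianMetric.IsStronglyCausal.exists_forall_notMem_of_isCompact_holds`) — `stub_nonImprisonment`;
* O'Neill 1983, Ch. 5, Lemma 8 (`b = ∞` companion): an affinely parametrised geodesic ray with
  non-vanishing velocity has no future endpoint
  (`PseudoRiemannianMetric.isFutureEndless_Ici_of_isGeodesicOn`,
  `Literature.Geometry.Lorentzian.GeodesicRayEndless`, resting on the calculus lemma
  `Literature.Analysis.ODE.not_tendsto_nhds_of_norm_accel_le`) — `stub_escape`, `stub_rayEndless`;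

assembled (for both time orientations of the ray) by the crux disprover's landed lemma
`Theorems.ErgoregionBomb.Negative.trapping_clause_contradictory` (p73277). The stub names are those
registered for the line's skeleton (`Cruxes/ErgoregionBomb/Lines/Sketch.lean`).

**What this does NOT settle.** The implication holds with NO use of Ricci-flatness, of the horizon
hypotheses, of `T ≠ 0`, of the zero-energy condition, of `K ⊆ doc`, or of any mode analysis; no
Killing mode is constructed. The intended statement — a hole with a zero-energy null geodesic
trapped MODULO THE STATIONARY FLOW is not Killing-mode stable — is recorded and attacked in
`Summits/FinalStateConjecture/FinalStateConjecture/Cruxes/ErgoregionBomb/Disproof.lean` §B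
(`ErgoregionBombOrbit` = refuters' C′; `ErgoregionBombIntended` = C‴, which also replaces the global
horizon Killing field of `IsNonDegenerateHorizon` by a collar). The planner must restate this crux
and its sibling `ZeroEnergyRigidity` (stmt-FinalStateConjecture-10690, whose non-trapping hypothesis
is likewise automatic) through `StationaryAFBlackHole.HasZeroEnergyRayTrappedModFlow`.
-/

noncomputable section

set_option linter.dupNamespace false

open Set Filter
open scoped Manifold Topology

namespace Summit.FinalStateConjecture.FinalStateConjecture.Theorems

open Literature.Geometry.Lorentzian
open Summit.FinalStateConjecture.FinalStateConjecture.Theses.ZeroEnergyKerrOrBomb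

/-- Registered stub `stub_bernalSanchez` (closed by the tree): Bernal–Sánchez 2007, Thm. 3.2 —
globally hyperbolic ⇒ strongly causal — for the metric of a hole of the telescope and any time
orientation (`LorentzianMetric.bernalSanchez_isStronglyCausal_of_isGloballyHyperbolic_holds`).
[cite: BernalSanchez2007CQG, Thm. 3.2] -/
theorem stub_bernalSanchez (𝓑 : StationaryAFBlackHole.{0}) (τ : TimeOrientation 𝓑.metric) :
    𝓑.metric.bernalSanchez_isStronglyCausal_of_isGloballyHyperbolic τ :=
  LorentzianMetric.bernalSanchez_isStronglyCausal_of_isGloballyHyperbolic_holds _ τ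

/-- Registered stub `stub_nonImprisonment` (closed by the tree): under strong causality a
future-endless causal curve leaves every compact set never to return (O'Neill 1983, Ch. 14,
Lemma 13; `LorentzianMetric.IsStronglyCausal.exists_forall_notMem_of_isCompact_holds`), for the
metric of a hole of the telescope and any time orientation.
[cite: ONeillSemiRiemannian1983, Ch. 14, Lemma 13 (p. 407)] -/
theorem stub_nonImprisonment (𝓑 : StationaryAFBlackHole.{0}) (τ : TimeOrientation 𝓑.metric) :
    LorentzianMetric.IsStronglyCausal.exists_forall_notMem_of_isCompact 𝓑.metric τ :=
  LorentzianMetric.IsStronglyCausal.exists_forall_notMem_of_isCompact_holds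

/-- Registered stub `stub_escape` (closed by `Literature.Analysis.ODE.not_tendsto_nhds_of_norm_accel_le`):
a curve in a real normed space with velocity `u`, acceleration `w`, `‖w‖ ≤ C ‖u‖²` and `u ≠ 0` on
`[t₀, ∞)` does not converge as `t → ∞` (the scaling estimate behind O'Neill 1983, Ch. 5, Lemma 8,
read in a chart). [folklore] -/
theorem stub_escape {F : Type*} [NormedAddCommGroup F] [NormedSpace ℝ F]
    {x u w : ℝ → F} {C t₀ : ℝ}
    (hx : ∀ t, t₀ ≤ t → HasDerivAt x (u t) t)
    (hu : ∀ t, t₀ ≤ t → HasDerivAt u (w t) t)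
    (hw : ∀ t, t₀ ≤ t → ‖w t‖ ≤ C * ‖u t‖ ^ 2)
    (hu0 : ∀ t, t₀ ≤ t → u t ≠ 0) (x₀ : F) :
    ¬ Tendsto x atTop (𝓝 x₀) :=
  Literature.Analysis.ODE.not_tendsto_nhds_of_norm_accel_le hx hu hw hu0 x₀

/-- Registered stub `stub_rayEndless` (closed by
`PseudoRiemannianMetric.isFutureEndless_Ici_of_isGeodesicOn`, which uses the escape lemma through
`Literature.Geometry.Lorentzian.GeodesicRayEndless`; the hypothesis `hEsc` of the registered
signature is therefore not needed): an affinely parametrised geodesic of the Levi-Civita connection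
of `𝓑` on `[0, ∞)` with nowhere-vanishing velocity has no future endpoint — the `b = ∞` companion
of O'Neill 1983, Ch. 5, Lemma 8. [cite: ONeill1983, Ch. 5, Lemma 8] -/
theorem stub_rayEndless
    (_hEsc : ∀ {F : Type} [NormedAddCommGroup F] [NormedSpace ℝ F]
      {x u w : ℝ → F} {C t₀ : ℝ},
      (∀ t, t₀ ≤ t → HasDerivAt x (u t) t) → (∀ t, t₀ ≤ t → HasDerivAt u (w t) t) →
      (∀ t, t₀ ≤ t → ‖w t‖ ≤ C * ‖u t‖ ^ 2) → (∀ t, t₀ ≤ t → u t ≠ 0) →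
      ∀ x₀ : F, ¬ Tendsto x atTop (𝓝 x₀))
    (𝓑 : StationaryAFBlackHole.{0}) [𝓑.metric.HasLeviCivita] (γ : ℝ → 𝓑.carrier)
    (hg : IsGeodesicOn 𝓑.metric.leviCivita γ (Set.Ici 0))
    (hv : ∀ s : ℝ, 0 ≤ s → velocity (𝓡 4) γ s ≠ 0) : IsFutureEndless γ (Set.Ici 0) :=
  PseudoRiemannianMetric.isFutureEndless_Ici_of_isGeodesicOn 𝓑.metric.toPseudoRiemannianMetric
    (WithTop.coe_le_coe.mpr le_top) hg hv

/-- **The crux `ErgoregionBomb` of route `ZeroEnergyKerrOrBomb`, as typed, holds — vacuously.**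
For every hole `𝓑` of the telescope the trapping clause `∀ s ≥ 0, γ s ∈ K` (`K` compact, `γ` an
affinely parametrised null geodesic ray) contradicts `IsGloballyHyperbolic`: globally hyperbolic ⇒
strongly causal (Bernal–Sánchez 2007, Thm. 3.2) ⇒ a future-endless causal curve leaves every
compact set (O'Neill 1983, Ch. 14, Lemma 13), while an affine geodesic ray with non-zero velocity
is future endless (O'Neill 1983, Ch. 5, Lemma 8); composed by
`Negative.trapping_clause_contradictory` with the four registered stubs. None of the vacuum /
horizon / `T ≠ 0` / zero-energy / `K ⊆ doc` hypotheses is used and no Killing mode is constructed: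
the item is settled AS FILED, not as intended (restate via `HasZeroEnergyRayTrappedModFlow`, see the
module docstring). [folklore] -/
theorem ErgoregionBomb_of : ErgoregionBomb := by
  intro 𝓑 _ _ _ _ _ hgh _ γ K hg hz hK _ hin
  exact (ErgoregionBomb.Negative.trapping_clause_contradictory 𝓑
    (stub_bernalSanchez 𝓑) (stub_nonImprisonment 𝓑)
    (fun γ' hg' hv' ↦ stub_rayEndless (fun hx hu hw hu0 ↦ stub_escape hx hu hw hu0) 𝓑 γ' hg' hv')
    hgh hg (fun s hs ↦ (hz s hs).1) hK hin).elim

end Summit.FinalStateConjecture.FinalStateConjecture.Theorems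

end
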